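import Mathlib
import HarnessLib
import HarnessLib.Audit
import Summits.KontsevichZagierPeriods.Statement
import Literature.NumberTheory.Transcendental.LandauDefectLatticeTate
import HarnessLib.Audit.Status.Attr

/-!
Route: InverseLandau

DORMANT since 2026-08-24T17:37:48Z (reconciler: no traction for 6.9 d (last activity item-evidence-added at 2026-08-17T18:28:01Z); parked, not closed — `ledger route dormant route-KontsevichZagierPeriods-InverseLandau --off` to reactiva) — unstaffed, not closed; items shared with open routes are served there. `ledger route dormant <id> --off` reactivates.

# Route InverseLandau — inverse Landau rigidity — identically vanishing Tate-degenerate family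
periods are exact plus defect-lattice loop relators, and the certificates specialise to KZ chains

It suffices to show X = TateFamilyKernel ∧ TateLifting (card
inverse-landau-rigidity-defect-lattice). A TATE FAMILY is a
rational integrand P/Q ∈ ℚ[z₁,…,z_n][ϖ] on the open unit cube whose denominator degenerates to a
non-zero CONSTANT at ϖ = 0
(Q(z,0) ≡ c₀ ≠ 0: every singular stratum runs to infinity — the Tate point; equivalently P/Q is a
t-free RATIONAL element of
Ayoub's 𝒪†_alg(𝔸ⁿ)); it is ADMISSIBLE on (0,ε) if Q ≠ 0 on [0,1]ⁿ × (0,ε). TateFamilyKernel (the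
absolute shadow of INVERSE
LANDAU, transcendence-free): if the fibre integrals vanish for every ϖ ∈ (0,ε), then at every
real-algebraic ϖ₀ ∈ (0,ε) the fibre
[(0,1)ⁿ, P/Q(·,ϖ₀)] lies in `KZ.relations` — because (relative side; MOTIVATED by Ayoub's relative
calculus `AyoubRel`, but stated — rev 1 cone repair — over the clean Landau vocabulary
`AyoubRel.TateFamily₁ / landauSet / landauDatum / Landau.relationLattice` of
LandauDefectLatticeTate.lean and Mathlib power series) the kernel of term-by-term
integration on such families is generated by exact forms and loop/toric relators INDEXED BY THE
DEFECT LATTICE Λ(F) = ker_ℤ M(F)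
of multiplicative relations among the Landau functions, each with an algebraic Stokes-homotopy
certificate that is a genuine H21
chain after specialisation (cruxes InverseLandauRationalCurves, TateFamilyKernelCurves; supports
SplitDefectLattice,
DlogLoopRelator, FiveTermCertificate). TateLifting (the GPC-strength complement, declared): every c
∈ ker KZ.eval is, modulo
KZ.relations, a ℤ-combination of such fibres ("every period identity deforms to a Tate-degenerate
rational family identity").
Lean: `TateFamilyKernel ∧ TateLifting` — both conjuncts are the one-line bodies of the items below
over `Literature.NumberTheory.Transcendental.KZ.{FormalRep, IntegralRep, eval, of, relations}`,
`MvPolynomial.aeval`, `IsAlgebraic`, `AddSubgroup.closure` (folder Sketch.lean, lean check rc 0 —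
re-checked after the rev-1 restatements with imports Statement + LandauDefectLatticeTate only;
`theorem assembly_holds : Assembly` and `curves_of_general : TateFamilyKernel →
TateFamilyKernelCurves` proved there sorry-free).

## Assembly
Pure logic, PROVED in the folder's Sketch.lean (`theorem assembly_holds : Assembly`, rc 0):
TateFamilyKernel puts every generator
of the fibre subgroup into `KZ.relations` (`AddSubgroup.closure_le`), so `relations ⊔
closure(fibres) = relations` (`sup_eq_left`);
TateLifting then gives `KZ.eval c = 0 → c ∈ KZ.relations`, i.e.
`Literature.NumberTheory.Transcendental.KZKernelConjecture`, and
`Summit.KontsevichZagierPeriods.KernelForm.kontsevichZagierPeriods_of_kzKernelConjecture`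
(Theorems/KernelFormKernelImpliesStatement)
yields the summit. `curves_of_general : TateFamilyKernel → TateFamilyKernelCurves` (instantiate n :=
1) is also proved there.

Rationale: WHY THIS LINE. Transplant of analytic S-matrix theory (Landau 1959 / Cutkosky / Pham: singularities
of integrals in families, Picard–Lefschetz
discontinuities) onto the one PROVED form of the period conjecture, Ayoub's relative theorem
(Ayoub2015; AyoubRelKZRevisited Thm 1.7,
vendored as `AyoubRel.ayoub_relativeKZ_revisited`, proved only motivically): INVERSE LANDAU says
WHICH relators an identically
vanishing family period forces — exact forms plus relators indexed by the circuits of the defect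
lattice Λ(F) (n = 1: loops dlog φ
with φ(0) = φ(1); proof = partial fractions + the linear case of Ax's theorem, `ax_schanuel_holds`,
PROVED in the tree via
Rosenlicht1976 Prop. 4; weight 2: small five-term instances, Wojtkowiak1996) — and the Tate
degeneration kills every constant of
integration (all Landau functions → 1), which is exactly why Baker/GPC input disappears from the
family statement while it is
needed fibrewise (route LowDimension, item 0405). What prior routes lack and this supplies:
GaussManinCertificates proves only the
monodromy-CYCLIC sector and leaves the residue ("CyclicMerging") unnamed; AyoubSpecialisation used
Thm 1.7 as a black box whose
generators G have unknown radius of convergence and pivoted away; LiouvilleUnfolding needs a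
closed-form logarithmic primitive of
the given integrand. Here the relators are read off the family's Landau data, the n = 1 completeness
is a motive-free theorem on
paper, and the certificates are rational in (z, w, ϖ), hence specialise at EVERY admissible
algebraic parameter. Imported areas:
singularity theory of integrals (Landau/Pham, doi:10.1007/jhep08(2022)200), differential algebra
(Ax1971, Rosenlicht1976),
polylogarithm functional equations (Wojtkowiak1996, arXiv:1803.08585), functional transcendence for
the higher cruxes
(arXiv:2208.05182, Chiu2024). CONE REPAIR (rev 1, 2026-08-15, unit rrepair-…-d3a0f25e): every typed
item is now stated over the
Statement cone plus the landed definition-request files LandauDefectLattice(Tate).lean (Mathlib +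
HarnessLib only); the import of
AyoubRelativeStokes — whose base file AyoubRelative.lean carries the unproved motivic named fact
`ayoub_relativeKZ_revisited` next to the
vocabulary — is dropped, and the four AyoubRel-typed items (InverseLandauRationalCurves,
SplitDefectLattice, LandauLocalisation,
FiveTermCertificate) are restated 1:1 with unchanged roles; Ayoub's calculus stays the motivation
and the informal target of the
certificates, never a hypothesis (needs-fact: none).

RANKED CRUXES. #0 TateLifting (target) — every formal ℤ-combination c of KZ integral representations
with KZ.eval c = 0 lies in KZ.relations ⊔ the subgroup generated by FIBRES [(0,1)ⁿ, P/Q(·,ϖ₀)] of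
Tate families (Q(z,0) ≡ c₀ ≠ 0) admissible on (0,ε) (Q ≠ 0 on [0,1]ⁿ×(0,ε)) whose fibre integrals
vanish for all ϖ ∈ (0,ε), at real-algebraic ϖ₀ ∈ (0,ε) (card: Lifting; the GPC-strength half,
implied by the summit with the empty combination). (why it might fail: it is Conjecture 1's
deformation half (GPC-strength barriers apply): an identity reachable only through a non-Tate
degeneration, a regularised limit or a π-factor (Neg pressure points) would not be a sum of
Tate-family fibres modulo the four moves.) [KontsevichZagier2001, Ayoub2015, AyoubRelKZRevisited,
HuberMullerStach2017]
#2 TateFamilyKernel (crux) — for every n and every Tate family P/Q ∈ ℚ[z₁..z_n][ϖ] (Q(z,0) ≡ c₀ ≠ 0)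
admissible on (0,ε) whose open-cube fibre integrals vanish for all ϖ ∈ (0,ε): at every
real-algebraic ϖ₀ ∈ (0,ε), any representation with domain (0,1)ⁿ and integrand P/Q(·,ϖ₀) is a KZ
relation (card K1 + K3: no dark singularities + certificate specialisation, absolute shadow). [deps:
InverseLandauRationalCurves, TateFamilyKernelCurves, FiveTermCertificate] [difficulty: open-problem]
(why it might fail: n ≥ 2: Thm 1.7 certificates have a radius; reaching a given ϖ₀ needs
continuation past complex singular fibres of the Gauss–Manin system inside (0,ε), or non-Tate fibre
cohomology may force correspondence relators with no semialgebraic real certificate.)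
[AyoubRelKZRevisited, Ayoub2015, doi:10.1007/jhep08(2022)200, arXiv:2208.05182, Chiu2024,
KontsevichZagier2001]
#3 InverseLandauRationalCurves (crux) — INVERSE LANDAU IN DIMENSION ONE — the formal structure
theorem, in clean vocabulary (cone repair rev 1, 2026-08-15: restated from Ayoub's `AyoubRel.Odagger
/ intLaurent / ayoubGenerators` — whose file AyoubRelative.lean also carries the unproved motivic
fact `ayoub_relativeKZ_revisited` — to the landed definition-request vocabulary
`LandauDefectLatticeTate` + Mathlib power series). For a field k of characteristic 0 and a
one-variable Tate family T = P/Q (P, Q ∈ k[z][ϖ], Q(z,0) = c₀ ≠ 0; `AyoubRel.TateFamily₁`), let G ∈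
k[z][[ϖ]] solve Q·G = P (the ϖ-expansion of F = P/Q) and suppose every ϖ-coefficient integrates to
zero over [0,1] (∫ z^i = 1/(i+1)), i.e. ∫F = 0 in k[[ϖ]]. THEN over every algebraically closed K ⊇
k(ϖ): F = E′ + Σ_q c_q Σ_p n_{q,p}/(z − p) in K(z), where E = A/B is regular at 0, 1 with E(1) =
E(0), c_q ∈ K, p ranges over the pole branches (`AyoubRel.landauSet K F`), and every exponent vector
n_q is an EXACT multiplicative relation Π_p g_p^{n_{q,p}} = 1 among the Landau functions g_p =
(p−1)/p (`Landau.relationLattice (landauDatum K F)`; = the defect lattice Λ(F) at a Tate point,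
`TateFamily₁.defectLattice_eq_relationLattice`). Equivalently: the residue vector lies in K ⊗ Λ(F)
and the exact part is a loop. Proof plan: partial fractions over K; at a place of k(ϖ, poles) over ϖ
= 0 every pole runs to infinity (`TateFamily₁.one_lt_val_of_mem_landauSet`), so the g_p are
principal units and ∫F = E(1) − E(0) + Σ_p a_p log g_p with FORMAL logarithms (no constant of
integration survives); Ax's theorem (`ax_schanuel_holds`, one derivation d/dϖ) on a multiplicative
basis of ⟨g_p⟩ forces a ∈ K ⊗ Λ(F), and then E(1) = E(0). Nothing is lost against the former
'rational, t-free, z₀-only F ∈ 𝒪((ϖ))' wording: a rational element of k[z]((ϖ)) is ϖ^(−N)·(P/Q) with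
Q(z,0) = 1 (Fatou's lemma for the integrally closed noetherian domain k[z]; folklore, grounder to
confirm), and the former conclusion 'F ∈ span of Ayoub's generators (a),(b)' follows informally from
this decomposition by the two-variable Stokes homotopy Ψ = (1−w)Φ(0) + wΦ(z) per loop — it is NOT
needed by the assembly, which consumes the decomposition fibrewise (TateFamilyKernelCurves via
DlogLoopRelator). [deps: SplitDefectLattice, LandauLocalisation] [difficulty: XL] (why it might
fail: Maths is Ax (proved) + partial fractions, but the Lean route needs k(ϖ, poles) embedded at a
place over ϖ = 0 into a Puiseux/Laurent field with formal log, and partial fractions over K — absent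
from Mathlib; ramified pole branches force fractional exponents throughout.) [AyoubRelKZRevisited,
Ax1971, Rosenlicht1976, Stichtenoth2009, MizeraTelen2022, Ayoub2015]
#4 TateFamilyKernelCurves (crux) — the n = 1 case of TateFamilyKernel: for a Tate family P/Q ∈
ℚ[z₀][ϖ] admissible on (0,ε) with ∫₀¹ P/Q(z,ϖ) dz = 0 for all ϖ ∈ (0,ε), the fibre [(0,1),
P/Q(·,ϖ₀)] at every real-algebraic ϖ₀ ∈ (0,ε) is a KZ relation — unconditional sector
theorem-candidate of Conjecture 1, with NO Baker input (plan: structured n = 1 inverse Landau ⇒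
F(·,ϖ₀) = E′ + Σ c_r dlog φ_r with φ_r(0) = φ_r(1), winding 0 on the whole admissible range; real
parts via DlogLoopRelator on φφ̄, argument parts via the Ψ_N homotopy; discriminant fibres by the
closed-subspace limit of the residue vector). [deps: InverseLandauRationalCurves, DlogLoopRelator,
SplitDefectLattice] [difficulty: L] (why it might fail: the argument part Im(c_r dlog φ_r) has no
semialgebraic primitive (arg φ is an arctangent); its certificate needs the N-th-root homotopy Ψ_N
with a continuous semialgebraic branch along [0,1], and discriminant fibres ϖ₀ need the limiting
lattice — either may resist the four moves as fixed.) [KontsevichZagier2001, AyoubRelKZRevisited,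
Ax1971, BakerTNT1975, Ayoub2015]
#9 SplitDefectLattice (support) — LANDAU LOG LATTICE — inverse Landau, split simple-pole case
(restated rev 1, 2026-08-15, over Mathlib power series; was over AyoubRel Laurent series): for u_i ∈
k[ϖ] let L_i = log(1 − ϖu_i) ∈ ϖk[[ϖ]] (pinned by L_i(0) = 0 and (1 − ϖu_i)·L_i′ = −(ϖu_i)′) — these
are −ϖ·∫₀¹ u_i/(1 − ϖu_i z) dz, the integrals of the split Tate family with poles 1/(ϖu_i) → ∞ and
Landau functions g_i = 1 − ϖu_i. If C_i ∈ k[[ϖ]] are algebraic over k[ϖ] and Σ_i C_i L_i = 0, then C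
= Σ_q c_q n_q with every n_q an EXACT relation Π_i (1 − ϖu_i)^{n_{q,i}} = 1 in k(ϖ) and c_q ∈
k[[ϖ]]. Proof: Λ is saturated, so ℤ^m = Λ ⊕ M; the g^n (n in a basis of M) are multiplicatively
independent with g(0) = 1, hence their logs are ℚ-independent modulo constants and, by Ax
(`ax_schanuel_holds` with the single derivation d/dϖ on k((ϖ)), constants k), algebraically — a
fortiori k(ϖ)^alg-linearly — independent; u_i = 0 gives g_i = 1, e_i ∈ Λ, consistent. [difficulty:
M] [Ax1971, Rosenlicht1976, AyoubRelKZRevisited]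
#9 LandauLocalisation (support) — LOCALISATION ('multiplicatively independent singularities never
cancel'), the Λ = 0 case (restated rev 1, 2026-08-15, over Mathlib power series): for DISTINCT
non-zero λ_i ∈ k and C_i ∈ k[[ϖ]] algebraic over k[ϖ], Σ_i C_i log(1 − λ_iϖ) = 0 (logs pinned by
L_i(0) = 0, (1 − λ_iϖ)·L_i′ = −λ_i) forces every C_i = 0: the 1 − λ_iϖ are pairwise non-associate
primes of k[ϖ], hence multiplicatively independent, so their logarithms are algebraically
independent over k(ϖ) by Ax (`ax_schanuel_holds`) and in particular linearly independent over
k(ϖ)^alg ∩ k[[ϖ]]. (∫₀¹ λ/(1 − ϖλz) dz = −ϖ⁻¹ log(1 − λϖ) is the link to the family picture.)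
[difficulty: provable-now] [Ax1971, Rosenlicht1976, AyoubRelKZRevisited]
#9 DlogLoopRelator (support) — the SPECIALISED LOOP CERTIFICATE is an H21 chain (card P1): for φ
ℚ-semialgebraic, continuous and positive on [0,1], differentiable on (0,1), with φ(0) = φ(1), the
representation [(0,1), φ′/φ] lies in KZ.relations. Certificate: Ψ(z,w) = (1−w)φ(0) + wφ(z) > 0, A =
Ψ_w/Ψ, B = Ψ_z/Ψ, ∂_zA = ∂_wB = φ(0)φ′/Ψ², A(0,w) = A(1,w) = 0, B(z,1) = φ′/φ, B(z,0) = 0: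
newtonLeibnizRel along w, coordinate-swap changeOfVariablesRel, newtonLeibnizRel along z, [τ,0] ∈
relations. (0-dim-base case of LiouvilleUnfolding.LogPrimitiveNL, with an independent purely
algebraic certificate.) [difficulty: provable-now] [KontsevichZagier2001, AyoubRelKZRevisited]
#9 FiveTermCertificate (support) — WEIGHT-2 CALIBRATION, fibre form (restated rev 1, 2026-08-15,
from 'lies in the span of Ayoub's generators' to the clean KZ statement the assembly consumes — the
n = 2, weight-2 instance of TateFamilyKernel made explicit): for REAL ALGEBRAIC x, y with 0 < x, 0 <
y, x + y < 1 (so the five Abel arguments a₁ = x, a₂ = y, a₃ = x/(1−y), a₄ = y/(1−x), a₅ =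
xy/((1−x)(1−y)) all lie in (0,1)), every representation over the open square (0,1)² with integrand
a₃/(1−a₃z₀z₁) + a₄/(1−a₄z₀z₁) − a₁/(1−a₁z₀z₁) − a₂/(1−a₂z₀z₁) − a₅/(1−a₅z₀z₁) − x/(1−xz₀)·y/(1−yz₁)
lies in KZ.relations. Its value is Li₂(a₃) + Li₂(a₄) − Li₂(a₁) − Li₂(a₂) − Li₂(a₅) −
log(1−x)log(1−y) = 0 (Abel's five-term identity; ∫∫ a/(1−az₀z₁) = Li₂(a), ∫ x/(1−xz₀) = −log(1−x);
re-verified this session at (x,y) ∈ {(0.1,0.12),(0.3,0.3),(0.45,0.5),(0.2,0.7)}: |value| ≤ 7e−16 by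
series, 2-D Simpson of the integrand ≤ 1.3e−9). Plan: Tate homotopy in one auxiliary cube variable w
(x ↦ xw: one newtonLeibnizRel in w from the fibre x = 0, whose integrand is literally 0), the
w-derivative being a weight-1 logarithmic combination certified by loop relators with parameters
(DlogLoopRelator pattern) and additivity. [difficulty: L] [Zagier2007Dilogarithm, Wojtkowiak1996,
KontsevichZagier2001]

TWO-LAYER PLAN. Foreseen glued splits (k ≤ 3, depth 1), filed only when a crux closes:
TateFamilyKernelCurves ⇐ CurveRelativeDecomposition (the
structured n = 1 theorem at the fibre: F(·,ϖ₀) = E′ + Σ Re/Im(c_r dlog φ_r)) → ArgLoopRelator (the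
Ψ_N certificate for d arg φ,
winding 0) → TateFamilyKernelCurves (glue: integrand additivity + DlogLoopRelator); TateFamilyKernel
⇐ SmallParameterTransfer
(Ayoub-type certificate with radius ρ specialises for algebraic ϖ₀ < ρ: Nash data on the closed
cube, one newtonLeibnizRel per
generator as in AyoubSpecialisation item 0543) → TateTransport (flat transport ϖ₁ → ϖ₀ inside (0,ε)
by one Newton–Leibniz move in
the parameter + rational Gauss–Manin certificates, GaussManinCertificates engine) →
TateFamilyKernel; InverseLandauRationalCurves ⇐
SplitDefectLattice → TatePlaceExpansion (partial fractions over K; embedding of k(ϖ, poles) at a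
place over ϖ = 0 with formal
log, turning ∫F = 0 into E(1) − E(0) + Σ a_p log g_p = 0) → InverseLandauRationalCurves;
FiveTermCertificate ⇐ TateHomotopy (x ↦ xw in
an auxiliary cube variable, one newtonLeibnizRel from the zero fibre) → weight-1 loop relators with
parameters (DlogLoopRelator pattern).

KILL CRITERIA. Refutation of TateFamilyKernelCurves (a fibre of an identically vanishing admissible
Tate family on (0,1) provably outside
KZ.relations) closes the route (`refuted:TateFamilyKernelCurves`) AND contradicts LowDimension's
Baker crux 0405 — report to the
operator as a probable defect of the fixed calculus. Refutation of InverseLandauRationalCurves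
(rev-1 form: a one-variable Tate family with ∫F = 0 whose residue vector is NOT in
K ⊗ Λ(F), or whose exact part is not a loop) kills the inverse-Landau mechanism itself: close
`refuted:InverseLandauRationalCurves` unless the
refuter classes it misstated (then repair the typing); such a family would also be a candidate
counterexample to Thm 1.7's rational sector —
escalate to the operator.
Refutation of TateFamilyKernel in n ≥ 2 with the curve case proved = a DARK SINGULARITY: pivot the
informal NoDarkSingularities to
the negative side (hand the family to route Neg as an obstruction candidate) and shrink X to the
linearly-reducible/mixed-Tate range.
Refutation of DlogLoopRelator, LandauLocalisation, SplitDefectLattice or FiveTermCertificate means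
the typed hypotheses are wrong
(restate, not close): all four are theorems on paper. KZKernelConjecture proved
elsewhere moots TateLifting; Thm 1.7 formalised motivically would NOT moot
InverseLandauRationalCurves' role (radius-free certificates).

NOT DECOMPOSED YET. NoDarkSingularities for all n (card K1: iterated-discontinuity tensor ∈ ker
M(F)^⊗, generation by exact + products + toric-loop
relators attached to circuits of Λ(F)) and InverseLandauAlgebraicCurves (card K2: algebraic
one-forms, isogeny/endomorphism graphs of
the generalized Jacobian via Deligne 1-motives) are filed INFORMALLY right after open — K1 needs the
n-variable Landau data (A-discriminants; the landed
LandauDefectLattice.lean takes the datum Δ as input) and K2 relative de Rham vocabulary. The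
Tate-homotopy lemma
(ϖ ↦ z_jϖ / x ↦ xw), the place-over-ϖ = 0 embedding with formal logarithms, Puiseux bookkeeping,
Fatou's normal form, semialgebraic branch selection for Ψ_N, and the "small-parameter transfer"
of Odagger certificates are prover lemmas (`--supports`) or layer-2 children, not items now.

CHEAPEST FALSIFIER. (i) SplitDefectLattice with m = 2, u = (1, 1+ϖ): a CAS expansion of C₁·log(1−ϖ)
+ C₂·log(1−ϖ−ϖ²) to O(ϖ⁸) for algebraic
C's — any vanishing combination with (C₁, C₂) ≠ 0 (here Λ = 0) kills the n = 1 theorem (the card ran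
the analogous exact-arithmetic LLL check on
a hidden 10-pole relator: residue vector found in the lattice). (ii) DlogLoopRelator is provable now
from the four move sets — if a
prover cannot close it within the fixed hypotheses of `newtonLeibnizRel`/`changeOfVariablesRel`,
every certificate of the line is
dead in this calculus. (iii) Lookup run this session: no elementary/certificate proof of any
infinite-rank rational case of Thm 1.7
beyond the tree's own `oddGeom`/`loopPullback` instances was found (lit search --hybrid, zbMATH,
crossref; OpenAlex/S2 rate-limited).

NUMBERS. Card computations (folder of the mechhunt seat, exact rational arithmetic): hidden relator
F = dlog[(1−ϖu₁)(1−ϖu₂)/(1−ϖu₃)] —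
all four boundary identities of the Ψ-certificate exact; at ϖ₀ = 1/10: ∫₀¹F = 1.6e−17, min Ψ = 2.08,
LLL on the 10 poles returns
exactly the 2 Landau relations; five-term family at ϖ₀ ∈ {0.1, 0.3, 0.45}: ∫_□F = O(1e−17), Landau
lattice rank 5 with 5 relations,
symbol tensor exactly 0 in ℤ^{5×5}. This session: Abel identity sign checked at (x,y) ∈
{(0.1,0.12),(0.2,0.05),(0.3,0.3)} to 2e−16.
Items at open: 9 typed (1 target, 1 assembly, 3 cruxes, 4 support) + 2 informal cruxes + 1
definition request filed after open.
Rev 1 (cone repair): the four restated decls + the five unchanged ones + `closes` re-elaborated in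
the folder's Sketch.lean with
imports Statement + LandauDefectLatticeTate only (lean check rc 0, 0 sorries); Abel identity
re-verified at four (x,y) (|value| ≤ 7e−16,
2-D Simpson ≤ 1.3e−9). Import cone after rev 1: Statement cone ∪ {LandauDefectLattice,
LandauDefectLatticeTate} — no closed Prop decl in either.

DEFINITION REQUESTS. notion LandauDefectLattice (topic Literature/NumberTheory/Transcendental,
beside AyoubRel): for a t-free rational F ∈ 𝒪†_alg(𝔸ⁿ)
(or a Tate family P/Q ∈ ℚ[z][ϖ]): the Landau set {Δ_α(ϖ)} (n = 1: g_p = (p−1)/p per pole p ∈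
k(ϖ)^alg; general n: irreducible
factors of the discriminants of Q restricted to the faces of the cube / principal A-determinant
factors), the LANDAU INCIDENCE
MATRIX M(F) = (ord_c Δ_α) over points c of the complete parameter curve, and Λ(F) := ker_ℤ M(F) =
multiplicative relations among the
Δ_α modulo constants — needed to state NoDarkSingularities. LANDED (2026-08-15):
LandauDefectLattice.lean (generic lattice,
places, incidence matrix; n = 1 landauSet/landauDatum/landauField), LandauDefectLatticeTate.lean
(TateFamily₁, poles run to infinity,
Λ = exact relations at a Tate point) — both Mathlib-only, now the route's sole Literature import —
and LandauTateFamilyOdagger.lean (the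
bridge TateFamily₁ → AyoubRel.Odagger; deliberately NOT imported, it sits on AyoubRelative.lean). No
cite-fact request: `ax_schanuel_holds`
and Rosenlicht Prop. 4 are proved in the tree; Thm 1.7 stays an unused named fact outside the cone.

Novelty: Searches (2026-08-15): this session — `lit frontier KontsevichZagierPeriods --since 2020` (30 rows;
nearest arXiv:2303.05030, GPC for
CM Kummer surfaces; nothing on relative-KZ certificates), `lit bridges KontsevichZagierPeriods
--cross any` (30 rows, none relevant),
`lit search --hybrid "relative Kontsevich-Zagier conjecture families elementary proof rational forms
logarithmic"` (8 held books:
HuberWustholz2022 pp 10/222, BakerWustholz2007, AomotoKita2011 p 311, Pila2022, KatoUsui2009 — none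
treats an elementary case of
Thm 1.7), `lit search --source zbmath "Kontsevich-Zagier period conjecture relative"` (2:
doi:10.4007/annals.2015.181.3.2,
arXiv:2507.15020), `lit search --source crossref "Wojtkowiak functional equations iterated
integrals"` (6; Wojtkowiak1996 =
doi:10.1017/s0027763000005675 added to bib), `lit search --source crossref "Ax-Schanuel mixed period
mappings"` (6; Chiu2024
doi:10.1007/s00208-024-02958-x, Gao 2020), `lit galaxy search "conjecture des périodes" --star all`
(7: Zannier colloquium,
HuberWustholz, Yoshinaga's Japanese KZ monograph panama:507398846414928, MurtyRath, Weinzierl),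
`"Landau singularities" --star pdf`
(8, all particle physics), `"functional equations of the dilogarithm" --star all` (0); OpenAlex/S2
HTTP 429. Plus the card's
audited searches (Ayoub citers ×33 incl. arXiv:2208.05182 §4.7; crossref ×5; galaxy ×4; `ledger idea
list` 123 cards) and
`ledger negatives` (0) re-read today; 62 route files grepped (only PhiFourLaboratory mentions Land  [refs: 10.4007/annals.2015.181.3.2, 10.1017/s0027763000005675, 10.1007/s00208-024-02958-x, 10.2748/tmj/1568772181, 2303.05030, 2507.15020, 2208.05182, doi:10.4007/annals.2015.181.3.2, doi:10.1017/s0027763000005675, doi:10.1007/s00208-024-02958-x, doi:10.2748/tmj/1568772181, HuberWustholz2022, BakerWustholz2007, AomotoKita2011, Pila2022, Wojtkowiak1996, Chiu2024, Ayoub2015]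

Barriers (technique_class: landau-singularity-analysis; picard-lefschetz; ax-kolchin): - technique_class: landau-singularity-analysis; picard-lefschetz; ax-kolchin
- Literature.Barriers.KontsevichZagierPeriods.noSemialgebraicPrimitive_inv_sub_two: evaded by
construction — no primitive OF an integrand is ever taken; every Newton–Leibniz primitive is a GIVEN
rational/semialgebraic function (A = Ψ_w/Ψ, B = Ψ_z/Ψ, polynomial primitives of the exact part) in
one auxiliary cube variable, i.e. Ayoub's Rem 1.5 evasion made systematic and indexed by Λ(F); the
argument part uses the algebraic Ψ_N homotopy precisely because arg φ has no semialgebraic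
primitive.
- Literature.Barriers.KontsevichZagierPeriods.kzConjecture_implies_oddZetaAlgIndep: applies to
TateLifting only (declared GPC-strength, rank 0); TateFamilyKernel(Curves),
InverseLandauRationalCurves and the supports assert no transcendence / independence statement — the
families vanish identically and the Tate point kills constants; FiveTermCertificate (rev 1)
certifies ONE classical identity (Abel's five-term relation at algebraic arguments) inside
KZ.relations, the accessible direction, from which no algebraic-independence statement follows.
- Literature.Barriers.KontsevichZagierPeriods.kzConjecture_implies_twoPiI_log_algIndep: same
division — engaged only through TateLifting; the winding-zero clause of the loop relators is exactly
where 2πi would enter and is excluded on the admissible range.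
- Literature.Barriers.KontsevichZagierPeriods.kzConjecture_implies_ellipticPeriods_algIndep: same;
no elliptic identity i

History (route lifecycle, newest last):
- 2026-08-15T21:33:15Z · rev 1: restated InverseLandauRationalCurves (stmt-KontsevichZagierPeriods-9131), SplitDefectLattice (stmt-KontsevichZagierPeriods-9133), LandauLocalisation (stmt-KontsevichZagierPeriods-9134), FiveTermCertificate (stmt-KontsevichZagierPeriods-9136) — route-repair (cone, unit rrepair-KontsevichZagierPeriods-Invers-d3a0f (planner-rrepair-KontsevichZagierPeriods-Invers-d3a0f25e-0)
- 2026-08-16T04:08:39Z · AUTO-CRUX (backfill): TateLifting — hypotheses of the deciding theorem that nothing in the route derives are cruxes (operator:999:1085951)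
- 2026-08-24T17:37:48Z · DORMANT — reconciler: no traction for 6.9 d (last activity item-evidence-added at 2026-08-17T18:28:01Z); parked, not closed — `ledger route dormant route-KontsevichZagier (operator:999:3842012)

sub-problem: KontsevichZagierPeriods · status: dormant · opened planner-plancard-KontsevichZagierPeriods-Kont-a7c82421-0 2026-08-15T13:50:43Z · rev 2 · ledger route-KontsevichZagierPeriods-InverseLandau
GENERATED by the gate from the ledger (D-0016/17). Provers cite these decls: `theorem foo : Summit.KontsevichZagierPeriods.KontsevichZagierPeriods.Theses.InverseLandau.<Decl> := …` in Summits/KontsevichZagierPeriods/KontsevichZagierPeriods/Theorems/<Name>.lean.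
-/

namespace Summit.KontsevichZagierPeriods.KontsevichZagierPeriods.Theses.InverseLandau

open scoped BigOperators Topology Manifold Classical MeasureTheory ProbabilityTheory Matrix InnerProductSpace ComplexConjugate ContinuousMap
open Filter Set Function TopologicalSpace MeasureTheory

attribute [summit_statement] _root_.KontsevichZagierPeriods

open Literature Periods

/-- item stmt-KontsevichZagierPeriods-9129 · crux (kind.auto-crux: conjecture-grade) · rank 0 · open · by planner
why it might fail: it is Conjecture 1's deformation half (GPC-strength barriers apply): an identity reachable only through a non-Tate degeneration, a regularised limit or a π-factor (Neg pressure points) would not be a sum of Tate-family fibres modulo the four moves.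
sources: KontsevichZagier2001, Ayoub2015, AyoubRelKZRevisited, HuberMullerStach2017
[target] every formal ℤ-combination c of KZ integral representations with KZ.eval c = 0 lies in
KZ.relations ⊔ the subgroup generated by FIBRES [(0,1)ⁿ, P/Q(·,ϖ₀)] of Tate families (Q(z,0) ≡ c₀ ≠
0) admissible on (0,ε) (Q ≠ 0 on [0,1]ⁿ×(0,ε)) whose fibre integrals vanish for all ϖ ∈ (0,ε), at
real-algebraic ϖ₀ ∈ (0,ε) (card: Lifting; the GPC-strength half, implied by the summit with the
empty combination). -/
@[route_item "route-KontsevichZagierPeriods-InverseLandau", crux]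
def TateLifting : Prop :=
  ∀ c : Literature.NumberTheory.Transcendental.KZ.FormalRep, Literature.NumberTheory.Transcendental.KZ.eval c = 0 → c ∈ Literature.NumberTheory.Transcendental.KZ.relations ⊔ AddSubgroup.closure {d : Literature.NumberTheory.Transcendental.KZ.FormalRep | ∃ (n : ℕ) (P Q : MvPolynomial (Fin (n + 1)) ℚ) (ε ϖ₀ : ℝ) (r : Literature.NumberTheory.Transcendental.KZ.IntegralRep n), 0 < ε ∧ (∃ c₀ : ℚ, c₀ ≠ 0 ∧ ∀ z : Fin n → ℝ, MvPolynomial.aeval (Fin.snoc z (0 : ℝ) : Fin (n + 1) → ℝ) Q = (c₀ : ℝ)) ∧ (∀ (z : Fin n → ℝ) (ϖ : ℝ), (∀ i, z i ∈ Set.Icc (0 : ℝ) 1) → ϖ ∈ Set.Ioo 0 ε → MvPolynomial.aeval (Fin.snoc z ϖ : Fin (n + 1) → ℝ) Q ≠ 0) ∧ (∀ ϖ ∈ Set.Ioo (0 : ℝ) ε, ∫ z in Set.pi Set.univ (fun _ : Fin n => Set.Ioo (0 : ℝ) 1), MvPolynomial.aeval (Fin.snoc z ϖ : Fin (n + 1)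 → ℝ) P / MvPolynomial.aeval (Fin.snoc z ϖ : Fin (n + 1) → ℝ) Q = 0) ∧ IsAlgebraic ℚ ϖ₀ ∧ ϖ₀ ∈ Set.Ioo 0 ε ∧ r.domain = Set.pi Set.univ (fun _ : Fin n => Set.Ioo (0 : ℝ) 1) ∧ Set.EqOn r.integrand (fun z => MvPolynomial.aeval (Fin.snoc z ϖ₀ : Fin (n + 1) → ℝ) P / MvPolynomial.aeval (Fin.snoc z ϖ₀ : Fin (n + 1) → ℝ) Q) r.domain ∧ d = Literature.NumberTheory.Transcendental.KZ.of r}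

/-- item stmt-KontsevichZagierPeriods-9130 · crux · rank 2 · open · by planner
why it might fail: n ≥ 2: Thm 1.7 certificates have a radius; reaching a given ϖ₀ needs continuation past complex singular fibres of the Gauss–Manin system inside (0,ε), or non-Tate fibre cohomology may force correspondence relators with no semialgebraic real certificate.
sources: AyoubRelKZRevisited, Ayoub2015, doi:10.1007/jhep08(2022)200, arXiv:2208.05182, Chiu2024, KontsevichZagier2001
[crux] for every n and every Tate family P/Q ∈ ℚ[z₁..z_n][ϖ] (Q(z,0) ≡ c₀ ≠ 0) admissible on (0,ε)
whose open-cube fibre integrals vanish for all ϖ ∈ (0,ε): at every real-algebraic ϖ₀ ∈ (0,ε), any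
representation with domain (0,1)ⁿ and integrand P/Q(·,ϖ₀) is a KZ relation (card K1 + K3: no dark
singularities + certificate specialisation, absolute shadow). [deps: InverseLandauRationalCurves,
TateFamilyKernelCurves, FiveTermCertificate] [difficulty: open-problem] -/
@[route_item "route-KontsevichZagierPeriods-InverseLandau", crux]
def TateFamilyKernel : Prop :=
  ∀ (n : ℕ) (P Q : MvPolynomial (Fin (n + 1)) ℚ) (ε : ℝ), 0 < ε → (∃ c₀ : ℚ, c₀ ≠ 0 ∧ ∀ z : Fin n → ℝ, MvPolynomial.aeval (Fin.snoc z (0 : ℝ) : Fin (n + 1) → ℝ) Q = (c₀ : ℝ)) → (∀ (z : Fin n → ℝ) (ϖ : ℝ), (∀ i, z i ∈ Set.Icc (0 : ℝ) 1) → ϖ ∈ Set.Ioo 0 ε → MvPolynomial.aeval (Fin.snoc z ϖ : Fin (n + 1) → ℝ) Q ≠ 0) → (∀ ϖ ∈ Set.Ioo (0 : ℝ) ε, ∫ z in Set.pi Set.univ (fun _ : Fin n => Set.Ioo (0 : ℝ) 1), MvPolynomial.aeval (Fin.snoc z ϖ : Fin (n + 1) → ℝ) P / MvPolynomial.aeval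 (Fin.snoc z ϖ : Fin (n + 1) → ℝ) Q = 0) → ∀ ϖ₀ : ℝ, IsAlgebraic ℚ ϖ₀ → ϖ₀ ∈ Set.Ioo 0 ε → ∀ r : Literature.NumberTheory.Transcendental.KZ.IntegralRep n, r.domain = Set.pi Set.univ (fun _ : Fin n => Set.Ioo (0 : ℝ) 1) → Set.EqOn r.integrand (fun z => MvPolynomial.aeval (Fin.snoc z ϖ₀ : Fin (n + 1) → ℝ) P / MvPolynomial.aeval (Fin.snoc z ϖ₀ : Fin (n + 1) → ℝ) Q) r.domain → Literature.NumberTheory.Transcendental.KZ.of r ∈ Literature.NumberTheory.Transcendental.KZ.relations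

-- earlier InverseLandauRationalCurves (stmt-KontsevichZagierPeriods-9131, replaced 2026-08-15T21:33:15Z -> stmt-KontsevichZagierPeriods-13872): retired by None — ∀ (k : Type) [Field k] [CharZero k] (F : LaurentSeries (Literature.NumberTheory.Transcendental.AyoubRel.O k)) (D N : Polynomial (Literature.NumberTheory.Transcendental.AyoubRel.O k)), F ∈ Literature.NumberTheory.Transcendental.AyoubRel.Odag
/-- item stmt-KontsevichZagierPeriods-13872 · crux · rank 3 · closed · proved by Summit.KontsevichZagierPeriods.InverseLandau.RationalCurves.InverseLandauRationalCurves_of @ bf8a1aa7fd3f (prover) · by planner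
why it might fail: Maths is Ax (proved) + partial fractions, but the Lean route needs k(ϖ, poles) embedded at a place over ϖ = 0 into a Puiseux/Laurent field with formal log, and partial fractions over K — absent from Mathlib; ramified pole branches force fractional exponents throughout.
sources: AyoubRelKZRevisited, Ax1971, Rosenlicht1976, Stichtenoth2009, MizeraTelen2022, Ayoub2015
[crux] INVERSE LANDAU IN DIMENSION ONE — the formal structure theorem, in clean vocabulary (cone
repair rev 1, 2026-08-15: restated from Ayoub's `AyoubRel.Odagger / intLaurent / ayoubGenerators` —
whose file AyoubRelative.lean also carries the unproved motivic fact `ayoub_relativeKZ_revisited` —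
to the landed definition-request vocabulary `LandauDefectLatticeTate` + Mathlib power series). For a
field k of characteristic 0 and a one-variable Tate family T = P/Q (P, Q ∈ k[z][ϖ], Q(z,0) = c₀ ≠ 0;
`AyoubRel.TateFamily₁`), let G ∈ k[z][[ϖ]] solve Q·G = P (the ϖ-expansion of F = P/Q) and suppose
every ϖ-coefficient integrates to zero over [0,1] (∫ z^i = 1/(i+1)), i.e. ∫F = 0 in k[[ϖ]]. THEN
over every algebraically closed K ⊇ k(ϖ): F = E′ + Σ_q c_q Σ_p n_{q,p}/(z − p) in K(z), where E =
A/B is regular at 0, 1 with E(1) = E(0), c_q ∈ K, p ranges over the pole branches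
(`AyoubRel.landauSet K F`), and every exponent vector n_q is an EXACT multiplicative relation Π_p
g_p^{n_{q,p}} = 1 among the Landau functions g_p = (p−1)/p (`Landau.relationLattice (landauDatum K
F)`; = the defect lattice Λ(F) at a Tate point, `TateFamily₁.defectLattice_eq_relationLattice`).
Equivalently: the residue vector -/
@[route_item "route-KontsevichZagierPeriods-InverseLandau"]
def InverseLandauRationalCurves : Prop :=
  ∀ (k : Type) [Field k] [CharZero k] (T : Literature.NumberTheory.Transcendental.AyoubRel.TateFamily₁ k) (G : PowerSeries (Polynomial k)), (T.Q : PowerSeries (Polynomial k)) * G = (T.P : PowerSeries (Polynomial k)) → (∀ j : ℕ, (PowerSeries.coeff j G).sum (fun i a => a / ((i : k) + 1)) = 0) → ∀ (K : Type) [Field K] [IsAlgClosed K] [Algebra (RatFunc k) K], ∃ (A B : Polynomial K) (s : ℕ) (c : Fin s → K) (nv : Fin s → (Literature.NumberTheory.Transcendental.AyoubRel.landauSet K T.toRatFunc → ℤ)), B.eval 0 ≠ 0 ∧ B.eval 1 ≠ 0 ∧ A.eval 1 * B.eval 0 = A.eval 0 * B.eval 1 ∧ (∀ q, nv q ∈ Literature.NumberTheory.Transcendental.AyoubRel.Landau.relationLattice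 (Literature.NumberTheory.Transcendental.AyoubRel.landauDatum K T.toRatFunc)) ∧ algebraMap (Polynomial K) (RatFunc K) ((Literature.NumberTheory.Transcendental.AyoubRel.TateFamily₁.toParamPoly T.P).map (algebraMap (RatFunc k) K)) / algebraMap (Polynomial K) (RatFunc K) ((Literature.NumberTheory.Transcendental.AyoubRel.TateFamily₁.toParamPoly T.Q).map (algebraMap (RatFunc k) K)) = algebraMap (Polynomial K) (RatFunc K) (Polynomial.derivative A * B - A * Polynomial.derivative B) / algebraMap (Polynomial K) (RatFunc K) (B ^ 2) + ∑ q, RatFunc.C (c q) * ∑ p : Literature.NumberTheory.Transcendental.AyoubRel.landauSet K T.toRatFunc, RatFunc.C ((nv q p : ℤ) : K) * (RatFunc.X - RatFunc.C (p : K))⁻¹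

/-- item stmt-KontsevichZagierPeriods-9132 · crux · rank 4 · closed · proved by Summit.KontsevichZagierPeriods.InverseLandau.TateFamilyKernelCurves_of @ 4221001d7a42 (prover) · by planner
why it might fail: the argument part Im(c_r dlog φ_r) has no semialgebraic primitive (arg φ is an arctangent); its certificate needs the N-th-root homotopy Ψ_N with a continuous semialgebraic branch along [0,1], and discriminant fibres ϖ₀ need the limiting lattice — either may resist the four moves as fixed.
sources: KontsevichZagier2001, AyoubRelKZRevisited, Ax1971, BakerTNT1975, Ayoub2015
[crux] the n = 1 case of TateFamilyKernel: for a Tate family P/Q ∈ ℚ[z₀][ϖ] admissible on (0,ε) with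
∫₀¹ P/Q(z,ϖ) dz = 0 for all ϖ ∈ (0,ε), the fibre [(0,1), P/Q(·,ϖ₀)] at every real-algebraic ϖ₀ ∈
(0,ε) is a KZ relation — unconditional sector theorem-candidate of Conjecture 1, with NO Baker input
(plan: structured n = 1 inverse Landau ⇒ F(·,ϖ₀) = E′ + Σ c_r dlog φ_r with φ_r(0) = φ_r(1), winding
0 on the whole admissible range; real parts via DlogLoopRelator on φφ̄, argument parts via the Ψ_N
homotopy; discriminant fibres by the closed-subspace limit of the residue vector). [deps:
InverseLandauRationalCurves, DlogLoopRelator, SplitDefectLattice] [difficulty: L] -/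
@[route_item "route-KontsevichZagierPeriods-InverseLandau"]
def TateFamilyKernelCurves : Prop :=
  ∀ (P Q : MvPolynomial (Fin 2) ℚ) (ε : ℝ), 0 < ε → (∃ c₀ : ℚ, c₀ ≠ 0 ∧ ∀ z : Fin 1 → ℝ, MvPolynomial.aeval (Fin.snoc z (0 : ℝ) : Fin 2 → ℝ) Q = (c₀ : ℝ)) → (∀ (z : Fin 1 → ℝ) (ϖ : ℝ), (∀ i, z i ∈ Set.Icc (0 : ℝ) 1) → ϖ ∈ Set.Ioo 0 ε → MvPolynomial.aeval (Fin.snoc z ϖ : Fin 2 → ℝ) Q ≠ 0) → (∀ ϖ ∈ Set.Ioo (0 : ℝ) ε, ∫ z in Set.pi Set.univ (fun _ : Fin 1 => Set.Ioo (0 : ℝ) 1), MvPolynomial.aeval (Fin.snoc z ϖ : Fin 2 → ℝ) P / MvPolynomial.aeval (Fin.snoc z ϖ : Fin 2 → ℝ) Q = 0) → ∀ ϖ₀ : ℝ, IsAlgebraic ℚ ϖ₀ → ϖ₀ ∈ Set.Ioo 0 ε → ∀ r : Literature.NumberTheory.Transcendental.KZ.IntegralRep 1, r.domain = Set.pi Set.univ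 (fun _ : Fin 1 => Set.Ioo (0 : ℝ) 1) → Set.EqOn r.integrand (fun z => MvPolynomial.aeval (Fin.snoc z ϖ₀ : Fin 2 → ℝ) P / MvPolynomial.aeval (Fin.snoc z ϖ₀ : Fin 2 → ℝ) Q) r.domain → Literature.NumberTheory.Transcendental.KZ.of r ∈ Literature.NumberTheory.Transcendental.KZ.relations

-- item stmt-KontsevichZagierPeriods-9425 · support · rank 5 · open · by planner — informal only, no Lean statement yet:
--   [crux] NO DARK SINGULARITIES (card K1; all dimensions; the inverse-Landau principle in full). For a
--   t-free RATIONAL F ∈ 𝒪†_alg(𝔸ⁿ) (a Tate family P/Q ∈ ℚ[z₁..z_n][ϖ], Q(z,0) ≡ c₀ ≠ 0) with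
--   term-by-term integral ∫F = 0: (i) the iterated-discontinuity (symbol) tensor of F lies slotwise in
--   ker M(F) ⊗ … ⊗ ker M(F), M(F) the Landau incidence matrix (rows = points of the complete parameter
--   curve, columns = Landau functions Δ_α of the face strata of the cube: factors of the discriminants
--   of Q restricted to faces / principal A-determinant); (ii) F ∈ exact forms (relA generators with
--   RATIONAL data) + k

-- item stmt-KontsevichZagierPeriods-9448 · support · rank 6 · open · by planner — informal only, no Lean statement yet:
--   [crux] INVERSE LANDAU FOR ALGEBRAIC CURVES (card K2; Théorème 1.7 for n = 1 and ALGEBRAIC, not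
--   rational, one-forms F ∈ 𝒪†_alg(𝔸¹), via 1-motives). For the relative curve X_ϖ carrying the
--   algebraic function F(z₀;ϖ), the annihilator of the monodromy orbit V of the path class [0,1] in
--   H¹_dR(X_ϖ ∖ poles, {0,1})/K is spanned by (a) exact forms, (b) toric loops dlog φ with φ(0) = φ(1),
--   indexed by the defect lattice of the toric part of the generalized Jacobian, and (c) graphs of
--   isogenies / endomorphisms of the generalized Jacobian J(X_ϖ, poles ∪ {0,1}) over K = k(ϖ)^alg
--   (Deligne, Hodge III §10.1: m

-- earlier SplitDefectLattice (stmt-KontsevichZagierPeriods-9133, replaced 2026-08-15T21:33:15Z -> stmt-KontsevichZagierPeriods-13873): retired by None — ∀ (k : Type) [Field k] [CharZero k] (m : ℕ) (u : Fin m → Polynomial k) (C : Fin m → LaurentSeries k) (S : Fin m → LaurentSeries (Literature.NumberTheory.Transcendental.AyoubRel.O k)), (∀ i, Literature.NumberTheory.Transcendental.AyoubRel.mapCoeff k 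
/-- item stmt-KontsevichZagierPeriods-13873 · support · rank 9 · closed · proved by Summit.KontsevichZagierPeriods.InverseLandau.SplitDefect.splitDefectLattice_proof @ 3e2dc781441f (prover) · by planner
sources: Ax1971, Rosenlicht1976, AyoubRelKZRevisited
[support] LANDAU LOG LATTICE — inverse Landau, split simple-pole case (restated rev 1, 2026-08-15,
over Mathlib power series; was over AyoubRel Laurent series): for u_i ∈ k[ϖ] let L_i = log(1 − ϖu_i)
∈ ϖk[[ϖ]] (pinned by L_i(0) = 0 and (1 − ϖu_i)·L_i′ = −(ϖu_i)′) — these are −ϖ·∫₀¹ u_i/(1 − ϖu_i z)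
dz, the integrals of the split Tate family with poles 1/(ϖu_i) → ∞ and Landau functions g_i = 1 −
ϖu_i. If C_i ∈ k[[ϖ]] are algebraic over k[ϖ] and Σ_i C_i L_i = 0, then C = Σ_q c_q n_q with every
n_q an EXACT relation Π_i (1 − ϖu_i)^{n_{q,i}} = 1 in k(ϖ) and c_q ∈ k[[ϖ]]. Proof: Λ is saturated,
so ℤ^m = Λ ⊕ M; the g^n (n in a basis of M) are multiplicatively independent with g(0) = 1, hence
their logs are ℚ-independent modulo constants and, by Ax (`ax_schanuel_holds` with the single
derivation d/dϖ on k((ϖ)), constants k), algebraically — a fortiori k(ϖ)^alg-linearly — independent;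
u_i = 0 gives g_i = 1, e_i ∈ Λ, consistent. [difficulty: M] -/
@[route_item "route-KontsevichZagierPeriods-InverseLandau"]
def SplitDefectLattice : Prop :=
  ∀ (k : Type) [Field k] [CharZero k] (m : ℕ) (u : Fin m → Polynomial k) (C L : Fin m → PowerSeries k), (∀ i, ∃ R : Polynomial (Polynomial k), R ≠ 0 ∧ Polynomial.eval₂ (Polynomial.coeToPowerSeries.ringHom (R := k)) (C i) R = 0) → (∀ i, PowerSeries.constantCoeff (L i) = 0 ∧ ((1 : PowerSeries k) - PowerSeries.X * (u i : PowerSeries k)) * PowerSeries.derivative k (L i) = -PowerSeries.derivative k (PowerSeries.X * (u i : PowerSeries k))) → ∑ i, C i * L i = 0 → ∃ (s : ℕ) (nv : Fin s → Fin m → ℤ) (c : Fin s → PowerSeries k), (∀ q, ∏ i, ((1 : RatFunc k) - RatFunc.X * algebraMap (Polynomial k) (RatFunc k) (u i)) ^ (nv q i) = 1) ∧ ∀ i, C i = ∑ q, (nv q i : PowerSeries k) * c q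

-- earlier LandauLocalisation (stmt-KontsevichZagierPeriods-9134, replaced 2026-08-15T21:33:15Z -> stmt-KontsevichZagierPeriods-13874): retired by None — ∀ (k : Type) [Field k] [CharZero k] (m : ℕ) (lam : Fin m → k) (C : Fin m → LaurentSeries k), Function.Injective lam → (∀ i, lam i ≠ 0) → (∀ i, Literature.NumberTheory.Transcendental.AyoubRel.mapCoeff k (Algebra.linearMap k (Literature.NumberTheory.T
/-- item stmt-KontsevichZagierPeriods-13874 · support · rank 9 · closed · proved by Summit.KontsevichZagierPeriods.InverseLandau.landauLocalisation_proof (prover) · by planner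
sources: Ax1971, Rosenlicht1976, AyoubRelKZRevisited
[support] LOCALISATION ('multiplicatively independent singularities never cancel'), the Λ = 0 case
(restated rev 1, 2026-08-15, over Mathlib power series): for DISTINCT non-zero λ_i ∈ k and C_i ∈
k[[ϖ]] algebraic over k[ϖ], Σ_i C_i log(1 − λ_iϖ) = 0 (logs pinned by L_i(0) = 0, (1 − λ_iϖ)·L_i′ =
−λ_i) forces every C_i = 0: the 1 − λ_iϖ are pairwise non-associate primes of k[ϖ], hence
multiplicatively independent, so their logarithms are algebraically independent over k(ϖ) by Ax
(`ax_schanuel_holds`) and in particular linearly independent over k(ϖ)^alg ∩ k[[ϖ]]. (∫₀¹ λ/(1 −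
ϖλz) dz = −ϖ⁻¹ log(1 − λϖ) is the link to the family picture.) [difficulty: provable-now] -/
@[route_item "route-KontsevichZagierPeriods-InverseLandau"]
def LandauLocalisation : Prop :=
  ∀ (k : Type) [Field k] [CharZero k] (m : ℕ) (lam : Fin m → k) (C L : Fin m → PowerSeries k), Function.Injective lam → (∀ i, lam i ≠ 0) → (∀ i, ∃ R : Polynomial (Polynomial k), R ≠ 0 ∧ Polynomial.eval₂ (Polynomial.coeToPowerSeries.ringHom (R := k)) (C i) R = 0) → (∀ i, PowerSeries.constantCoeff (L i) = 0 ∧ ((1 : PowerSeries k) - PowerSeries.C (lam i) * PowerSeries.X) * PowerSeries.derivative k (L i) = -PowerSeries.C (lam i)) → ∑ i, C i * L i = 0 → ∀ i, C i = 0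

-- earlier FiveTermCertificate (stmt-KontsevichZagierPeriods-9136, replaced 2026-08-15T21:33:15Z -> stmt-KontsevichZagierPeriods-13875): retired by None — ∀ (k : Type) [Field k] [CharZero k] (x y : Polynomial k) (D : Fin 5 → LaurentSeries (Literature.NumberTheory.Transcendental.AyoubRel.O k)) (Tx Ty : LaurentSeries (Literature.NumberTheory.Transcendental.AyoubRel.O k)), x.coeff 0 = 0 → y.coeff 0 = 0 
/-- item stmt-KontsevichZagierPeriods-13875 · support · rank 9 · closed · proved by Summit.KontsevichZagierPeriods.InverseLandau.FiveTerm.fiveTermCertificate_proof @ 14dc9d5365a6 (prover) · by planner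
sources: Zagier2007Dilogarithm, Wojtkowiak1996, KontsevichZagier2001
[support] WEIGHT-2 CALIBRATION, fibre form (restated rev 1, 2026-08-15, from 'lies in the span of
Ayoub's generators' to the clean KZ statement the assembly consumes — the n = 2, weight-2 instance
of TateFamilyKernel made explicit): for REAL ALGEBRAIC x, y with 0 < x, 0 < y, x + y < 1 (so the
five Abel arguments a₁ = x, a₂ = y, a₃ = x/(1−y), a₄ = y/(1−x), a₅ = xy/((1−x)(1−y)) all lie in
(0,1)), every representation over the open square (0,1)² with integrand a₃/(1−a₃z₀z₁) +
a₄/(1−a₄z₀z₁) − a₁/(1−a₁z₀z₁) − a₂/(1−a₂z₀z₁) − a₅/(1−a₅z₀z₁) − x/(1−xz₀)·y/(1−yz₁) lies in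
KZ.relations. Its value is Li₂(a₃) + Li₂(a₄) − Li₂(a₁) − Li₂(a₂) − Li₂(a₅) − log(1−x)log(1−y) = 0
(Abel's five-term identity; ∫∫ a/(1−az₀z₁) = Li₂(a), ∫ x/(1−xz₀) = −log(1−x); re-verified this
session at (x,y) ∈ {(0.1,0.12),(0.3,0.3),(0.45,0.5),(0.2,0.7)}: |value| ≤ 7e−16 by series, 2-D
Simpson of the integrand ≤ 1.3e−9). Plan: Tate homotopy in one auxiliary cube variable w (x ↦ xw:
one newtonLeibnizRel in w from the fibre x = 0, whose integrand is literally 0), the w-derivative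
being a weight-1 logarithmic combination certified by loop relators with parameters (DlogLoopRelator
pattern) and additivity. [difficulty: L] -/
@[route_item "route-KontsevichZagierPeriods-InverseLandau"]
def FiveTermCertificate : Prop :=
  ∀ (x y : ℝ), IsAlgebraic ℚ x → IsAlgebraic ℚ y → 0 < x → 0 < y → x + y < 1 → ∀ r : Literature.NumberTheory.Transcendental.KZ.IntegralRep 2, r.domain = Set.pi Set.univ (fun _ : Fin 2 => Set.Ioo (0 : ℝ) 1) → Set.EqOn r.integrand (fun z => (x / (1 - y)) / (1 - (x / (1 - y)) * z 0 * z 1) + (y / (1 - x)) / (1 - (y / (1 - x)) * z 0 * z 1) - x / (1 - x * z 0 * z 1) - y / (1 - y * z 0 * z 1) - (x * y / ((1 - x) * (1 - y))) / (1 - (x * y / ((1 - x) * (1 - y))) * z 0 * z 1) - (x / (1 - x * z 0)) * (y / (1 - y * z 1))) r.domain → Literature.NumberTheory.Transcendental.KZ.of r ∈ Literature.NumberTheory.Transcendental.KZ.relations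

/-- item stmt-KontsevichZagierPeriods-9135 · support · rank 9 · closed · proved by Summit.KontsevichZagierPeriods.InverseLandau.DlogLoopRelator_proof @ 6918b56b17fc (prover) · by planner
sources: KontsevichZagier2001, AyoubRelKZRevisited
[support] the SPECIALISED LOOP CERTIFICATE is an H21 chain (card P1): for φ ℚ-semialgebraic,
continuous and positive on [0,1], differentiable on (0,1), with φ(0) = φ(1), the representation
[(0,1), φ′/φ] lies in KZ.relations. Certificate: Ψ(z,w) = (1−w)φ(0) + wφ(z) > 0, A = Ψ_w/Ψ, B =
Ψ_z/Ψ, ∂_zA = ∂_wB = φ(0)φ′/Ψ², A(0,w) = A(1,w) = 0, B(z,1) = φ′/φ, B(z,0) = 0: newtonLeibnizRel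
along w, coordinate-swap changeOfVariablesRel, newtonLeibnizRel along z, [τ,0] ∈ relations.
(0-dim-base case of LiouvilleUnfolding.LogPrimitiveNL, with an independent purely algebraic
certificate.) [difficulty: provable-now] -/
@[route_item "route-KontsevichZagierPeriods-InverseLandau"]
def DlogLoopRelator : Prop :=
  ∀ (phi dphi : ℝ → ℝ) (r : Literature.NumberTheory.Transcendental.KZ.IntegralRep 1), Literature.NumberTheory.Transcendental.IsSemialgebraicFunOn ℚ {x : Fin 1 → ℝ | x 0 ∈ Set.Icc (0 : ℝ) 1} (fun x => phi (x 0)) → ContinuousOn phi (Set.Icc 0 1) → (∀ t ∈ Set.Icc (0 : ℝ) 1, 0 < phi t) → (∀ t ∈ Set.Ioo (0 : ℝ) 1, HasDerivAt phi (dphi t) t) → phi 0 = phi 1 → r.domain = {x | x 0 ∈ Set.Ioo (0 : ℝ) 1} → Set.EqOn r.integrand (fun x => dphi (x 0) / phi (x 0)) r.domain → Literature.NumberTheory.Transcendental.KZ.of r ∈ Literature.NumberTheory.Transcendental.KZ.relations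

/-- item stmt-KontsevichZagierPeriods-9137 · assembly · rank 1 · closed · proved by Summit.KontsevichZagierPeriods.InverseLandau.Assembly.assembly_proof @ 044ba48c176a (prover) · by planner
sources: KontsevichZagier2001, HuberMullerStach2017
[assembly] TateFamilyKernel → TateLifting → KontsevichZagierPeriods. -/
@[route_item "route-KontsevichZagierPeriods-InverseLandau"]
def Assembly : Prop :=
  TateFamilyKernel → TateLifting → KontsevichZagierPeriods

/-! D-0027 §2.1 — DECIDING THEOREM (planner-authored via `route open/edit --closes-file`; by planner-plancard-KontsevichZagierPeriods-Kont-a7c82421-0 2026-08-15T13:50:44Z):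
its hypotheses are this route's items and its conclusion the sub-problem Statement (glue_lint), and it elaborates with this file. -/

@[closes "route-KontsevichZagierPeriods-InverseLandau"] theorem closes : TateFamilyKernel → TateLifting → KontsevichZagierPeriods := by
  intro hK hL n m r r' _ _ hv
  refine sup_le le_rfl ((AddSubgroup.closure_le _).mpr ?_) (hL _ ?_)
  · rintro d ⟨n, P, Q, ε, ϖ₀, r, hε, hT, hA, hV, halg, hϖ₀, hdom, heq, rfl⟩
    exact hK n P Q ε hε hT hA hV ϖ₀ halg hϖ₀ r hdom heq
  · simp [Literature.NumberTheory.Transcendental.KZ.eval_of, hv]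

end Summit.KontsevichZagierPeriods.KontsevichZagierPeriods.Theses.InverseLandau
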